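import Literature.NumberTheory.Automorphic.Liu2021.CohHolMeetsThetaLiftFromLine              -- THE LETTER #113 frame + ★ `MeetsThetaLiftFromLine`, `lineThetaKernelDatum`, `cmArchSection`
import Literature.NumberTheory.Automorphic.Liu2021.ThetaLiftFromLineCoinvariantJunction      -- ★ `finPart`, `cmAdelicFrameTransport`, frame-transport uniqueness lemmas
import Literature.NumberTheory.Automorphic.Liu2021.ThetaLiftFromLineCharacters              -- ★ `eq_cmAdelicFrameTransport_of_coe`, character detection
import Literature.NumberTheory.Automorphic.UnitaryGroupCotangentSpectralProjection           -- ★ SP `holCotFormSpectralProjection` (projections of hol. cotangent classes)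
import Literature.NumberTheory.Automorphic.AdelicUnitaryGroupSpectrum                        -- ★ `isDiscretelyDecomposable_rightRegular_adelicGroupData`
import Summits.HodgeConjecture.HodgeConjecture.Theorems.F0P2cSocketC                         -- ★ (C♭) currency `rhoAtLine … ιV a χ`, `HasFinComponent`
import Summits.HodgeConjecture.HodgeConjecture.Theorems.F0P2sNodeBPrimeHolds                 -- ★ NODE B′ (`pr_P[Θ̃(χ)] ≠ 0 ⟹ P.HasFinComponent ω_H(μ,a,χ)`)
import Summits.HodgeConjecture.HodgeConjecture.Theorems.F0P2tThetaOccursInGenNeg             -- ★ Θ-OCC-GEN `thetaOccursInGen` (non-zero theta vectors in `cohForms`)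
import Summits.HodgeConjecture.HodgeConjecture.Theorems.F0LD1ThetaTransportKit               -- ★ pinned-`ιA` theta-lift class kit (`memLp_toQuotFun_lineThetaLift … ιA hιA …`)
import Summits.HodgeConjecture.HodgeConjecture.Theorems.K2E2FramePinsCoherent   -- ★ socket closer landed: `framePinsCoherent` (RE-TIE BY IMPORT, ED. 4)
import Summits.HodgeConjecture.HodgeConjecture.Theorems.K2E2CapThetaClassCaptureOriented   -- ★ #13R fold `capThetaClassCaptureOriented_of : ‹#12R› → ‹#10› → ‹#13R›` (p855041)
import Summits.HodgeConjecture.HodgeConjecture.Theorems.K2E2L2MemOfProjectionRigidity   -- ★ #10 `memOfProjectionRigidity` (p854820)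
import Summits.HodgeConjecture.HodgeConjecture.Theorems.F0P2tThetaPairNeZeroOfFrame   -- ★ (N5) vocabulary for #20 (`archWeilRep`, `proj_apply_eq_toSp`, `schwartzReindexCLM`)
import Summits.HodgeConjecture.HodgeConjecture.Theorems.K2E2CapHolThetaWitnessOrientedOfArchRows   -- ★ p855353 (K2E2-p12): `capHolThetaWitnessOriented_of_archRowsGen : ‹#20› → ‹#12R›` (RE-TIE of #12R MODULO #20, ED. 5)
import Summits.HodgeConjecture.HodgeConjecture.Theorems.K2E2CapArchRowsGenOfAllThetaData   -- ★ p855525 (K2E2-p12): `archRowsGen_of_forall_thetaData : ‹ARCH-ROWS-ALLDATA› → ‹#20›` (RE-TIE of #20 MODULO #20a, ED. 5)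
import Summits.HodgeConjecture.HodgeConjecture.Theorems.K2E2CapArchRowsAllDataOfPairHolCot   -- ★ p855623 (K2E2-p12): `archRowsAllData_of_pairHolCot : ‹#20a ARCH-PAIR-HOLCOT› → ‹ARCH-ROWS-ALLDATA›` (ED. 5)
import Summits.HodgeConjecture.HodgeConjecture.Theorems.K2E2CapArchPairHolCot   -- ★ p857161 (cand K2E2-p12 (g2) line lead, filed (g3)): `capArchPairHolCot : ‹#20a›` — the CLOSER of the one open E2-own leaf (TIE BY IMPORT, ED. 6)
import HarnessLib

/-!
ED. 6 (2026-09-04T03:52Z, dealer K2E2-plan (g2)): socket #20a `sig_K2E2CapArchPairHolCot` ★ CLOSED BY NAME `:= @Summit.HodgeConjecture.HodgeConjecture.Cruxes.H413.K2E2CapArchPairHolCot.capArchPairHolCot` (★ p857161, K2E2-p12 (g2) line lead; road H1 p855797 · H2 p856024+p856071 · H3 p855971 · H4a p856262 · Glue p856259 · A p856478 · B1 p856582 · B2a/B2b · AtPKG · Mirror · CLOSER); hence #20 and #12R (REL ties of ED. 5) and #13R are now ★ outright through ★ names only; statement bytes of every socket FROZEN; code-sorries 2 = the withdrawn-frozen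 #12/#13 negative edges only. E2-OWN OPEN SOCKETS: NONE.

ED. 5 (2026-09-04, dealer K2E2-plan (g2), MERGED with the (g0) candidate; design (i) of K2E2-p12's cut memo `CUT-ARCH-ROWS-GEN.K2E2-p12-g2.md` ADOPTED): + socket #20a `sig_K2E2CapArchPairHolCot` (ARCH-PAIR-HOLCOT, LINE currency = the hypothesis `hP` of ★ p855623 VERBATIM, ws-sha16 3efc5e019e17f8df) — the ONE OPEN E2-own leaf of the line; + socket #20 `sig_K2E2CapArchRowsGen` (ARCH-ROWS-GEN = `hA` of ★ p855353 VERBATIM) now CLOSED RELATIVE to #20a by ★ p855525 ∘ ★ p855623 (`archRowsGen_of_forall_thetaData (archRowsAllData_of_pairHolCot ‹#20a›)`); #12R CLOSED RELATIVE to #20 by ★ p855353 (R14 relative re-tie: one road, implications ★ by name, composite certified by K2E2-p12's `ProbePaste_Sig20Tie.lean` 2d65ac3d4f1c9f6b + this module's own check; statement bytes of #12R ∕ #20 FROZEN).  Live code-sorries: #20a only (+ the withdrawn-frozen #12 ∕ #13 = 3).  No `HodgeCM.Model` bytes are frozen in `Lines/` (the model-currency helpers H1 `K2E2CapArchKernelIdentity`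 ∕ H2 `K2E2CapArchMembershipTransport` ∕ H3 `K2E2CapArchPairFixedNeZero` live at Theorems level, statements the hands' own; closer `Theorems/K2E2CapArchPairHolCot.lean` = #20a token for token, line lead K2E2-p12).

RE-TIE EDITION (2026-09-03T22:20Z): every landed socket of this module is now `:= @<landed decl>` BY IMPORT (statement bytes frozen); see the per-theorem comments.

# K2 ∕ E2 «ThetaExhaustionByRigidity» — tier-1 sockets, units **FRAME** + **CAPTURE** (the pinned theta class and its capture)

ED. 3 (2026-09-03, R8 RE-CUT after the dealer's self-flag 21:13:25Z and K2E2-p06's pre-write flag 21:19:09Z): sockets #12 `sig_K2E2CapHolThetaWitness` and #13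
`sig_K2E2CapThetaClassCapture` are WITHDRAWN (bytes frozen = negative edge: #12 is FALSE, #13 roadless, at negative orientation `ι ∉ Φ_μ`); NEW sockets #12R
`sig_K2E2CapHolThetaWitnessOriented` and #13R `sig_K2E2CapThetaClassCaptureOriented` (= old + ONE binder `ι ∈ hμ.cmType.1`).  The negative orientation is excluded
in tier 0 (ED. 4) by the unit ORIENT (`K2_E2_ThetaExhaustionByRigidity_Orient.lean`: OR-1 generic-currency conjugate partner of `ω_H`, OR-2 the antiholomorphic
witness `StubAntiholWitnessOfNeg`) together with the junction letter E2′ `Rogawski1990.hodgeTypeRigid`.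

Track B «K2-LIT», engine E2 (Weil representation ∕ global theta ∕ Howe duality), crux H413 (`stmt-HodgeConjecture-24833`), route
`route-HodgeConjecture-HCCMUnconditional`.  Tier-0 line: `Cruxes/H413/Lines/K2_E2_ThetaExhaustionByRigidity.lean` (stub `stub_thetaClassCapture`,
`def StubThetaClassCapture`).  THIS IS THE E2 HEART of the line: `sig_K2E2CapHolThetaWitness` says that for weight-one `μ`, an `hμ.cmType`-ADMISSIBLE line
datum `(a, χ)` and the PINNED transports `ιA`, `ιV` of the TEL frame, some global theta lift `[Θ̃_Φ(f) ∘ ιA] ∈ L²([U(H)], μA)` from the hermitian line `⟨a⟩` is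
NON-ZERO and every discrete `P′` on which it projects non-trivially is HOLOMORPHIC-COTANGENT at `ι` with finite component `ω_H(μ, a, χ)[ιV]` — theta
non-vanishing for coherent data ([Liu2021, Prop. 4.13 proof «Conversely»; GelbartRogawski1991 §3; Θ-OCC-GEN ★), the archimedean theta correspondence
landing in holomorphic cotangent forms for admissible data ([Liu2021, App. D Lem. D.2 (`le:weil_arch`, l. 5279–5289, p. 127)]), ★ SP and ★ B′.  With `L2Completeness.sig_K2E2L2MemOfProjectionRigidity`
and the E1′-rigidity hypothesis of the tier-0 stub this closes `StubThetaClassCapture` (`sig_K2E2CapThetaClassCapture`, VERBATIM).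
No `def`∕`instance`∕`notation`; imports ★ only (R3 (d)).
HONEST LABEL: HC_CM is proved only modulo the 7 printed citations (2 remaining named inputs: hLiu418 = stmt-HodgeConjecture-24832, h413 =
stmt-HodgeConjecture-24833) until rung 0 closes; nothing here changes any count.

ED. 2 (cite fix per lit1 (g46) words #11 (5144): `le:weil_arch` = App. D Lem. D.2, not «Lem. 4.9» — Def. 4.9 is μ-canonical; socket statement bytes UNCHANGED).
-/

set_option Elab.async false
set_option autoImplicit false
set_option linter.dupNamespace false

namespace Summit.HodgeConjecture.HodgeConjecture.Cruxes.H413.K2E2ThetaExhaustionByRigidity.Capture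

open scoped TensorProduct Matrix Kronecker ComplexOrder ENNReal SchwartzMap
open NumberField NumberField.InfinitePlace IsDedekindDomain MeasureTheory
open Literature.NumberTheory Literature.NumberTheory.Automorphic Literature.NumberTheory.Automorphic.UnitaryGroup
open Literature.NumberTheory.Automorphic.UnitaryGroup.CotangentForms
open Literature.NumberTheory.Automorphic.Liu2021
open Literature.NumberTheory.Automorphic.Liu2021.Def411WeilCarriers
open Literature.NumberTheory.Automorphic.Liu2021.Def411WeilCarriersDoubling
open Literature.NumberTheory.Automorphic.IdeleClassGroup
open Literature.NumberTheory.GelbartRogawski1991 Literature.NumberTheory.GelbartRogawski1991.UnitaryDualPair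
open Literature.NumberTheory.GelbartRogawski1991.UnitaryDualPair.WeilCoinv
open Literature.NumberTheory.Weil1964
open Literature.RepresentationTheory Literature.RepresentationTheory.Liu2021
open Literature.RepresentationTheory.CompactGroups
open Literature.NumberTheory.Rogawski1990
open Literature.AlgebraicGeometry.Liu2021 (IsAdmissibleElement)
open Summit.HodgeConjecture.CorCM
open Summit.HodgeConjecture.CorCM.Transposition

/-! ## Unit FRAME — coherence of the two pinned transports -/

set_option synthInstance.maxHeartbeats 400000 in
set_option maxHeartbeats 8000000 in
/-- **sig FRAME-1 (size S) — the pinned adelic and finite-adelic transports are COHERENT: `(ιA (1, k))_f = ιV k`.**  In the TEL frame both transports are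
pinned by the same `g` (`hιA`, `hιV`), hence equal the canonical ones (★ `eq_cmAdelicFrameTransport_of_coe`, ★
`eq_finPart_cmAdelicFrameTransport_finAdelicToAdelic_of_coe`), for which the identity is ★ `cmAdelicFrameTransport_finAdelicToAdelic` ∕ `rfl` on components.
This is the plumbing that lets NODE B′ (canonical transports) be read at the pinned `ιA`, `ιV` of the letter.
[cite: BorelJacquet1979, §4.1] [cite: Liu2021, App. D §D.1 Steps 1–2 (l. 5217–5219)]
size: S · deps: ★ `eq_cmAdelicFrameTransport_of_coe`, ★ `eq_finPart_cmAdelicFrameTransport_finAdelicToAdelic_of_coe` · unit: FRAME ·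
tier-2 target `Theorems/K2E2FramePinsCoherent.lean` -/
theorem sig_K2E2FramePinsCoherent :
    ∀ (L : Type) [Field L] [NumberField L] [IsCMField L] (N : ℕ) (H : Matrix (Fin N) (Fin N) L) (dV : Fin N → L) (g : GL (Fin N) L)
      (hg : ((g : Matrix (Fin N) (Fin N) L).map (cmConjRingHom L))ᵀ * H * (g : Matrix (Fin N) (Fin N) L) = Matrix.diagonal dV)
      (ιA : (adelicGroupData (↥(maximalRealSubfield L)) L (IsCMField.complexConj L) N H).Adelic →*
          ↥(UnitaryGroup.adelic (↥(maximalRealSubfield L)) L (IsCMField.complexConj L) N (Matrix.diagonal dV))),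
      (∀ k, ((ιA k : ↥(UnitaryGroup.adelic (↥(maximalRealSubfield L)) L (IsCMField.complexConj L) N (Matrix.diagonal dV))) :
            GL (Fin N) (AdeleRing (𝓞 L) L)) =
          (toAdeleGL L g)⁻¹ * adelicVal (↥(maximalRealSubfield L)) L (IsCMField.complexConj L) N H k * toAdeleGL L g) →
      ∀ (ιV : finAdelic (↥(maximalRealSubfield L)) L (IsCMField.complexConj L) N H →*
          finAdelic (↥(maximalRealSubfield L)) L (IsCMField.complexConj L) N (Matrix.diagonal dV)),
      (∀ k, ((ιV k : finAdelic (↥(maximalRealSubfield L)) L (IsCMField.complexConj L) N (Matrix.diagonal dV)) :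
            GL (Fin N) (FiniteAdeleRing (𝓞 L) L)) =
          (toFinAdeleGL L N g)⁻¹ * (k : GL (Fin N) (FiniteAdeleRing (𝓞 L) L)) * toFinAdeleGL L N g) →
      ∀ k : finAdelic (↥(maximalRealSubfield L)) L (IsCMField.complexConj L) N H,
        finPart (↥(maximalRealSubfield L)) L (IsCMField.complexConj L) N (Matrix.diagonal dV)
            (ιA (finAdelicToAdelic (↥(maximalRealSubfield L)) L (IsCMField.complexConj L) N H k)) = ιV k :=
  @Summit.HodgeConjecture.HodgeConjecture.Cruxes.H413.K2E2FramePinsCoherent.framePinsCoherent  -- ★ RE-TIED BY IMPORT (statement bytes above FROZEN ∕ unchanged)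

/-! ## Unit CAPTURE — the pinned theta class: non-zero, holomorphic receivers, prescribed finite component; then capture -/

set_option synthInstance.maxHeartbeats 400000 in
set_option maxHeartbeats 16000000 in
/-- **WITHDRAWN (ED. 3, 2026-09-03; bytes kept frozen as the negative edge) — FALSE at negative orientation `ι ∉ hμ.cmType.1`: the theta forms of Φ_μ-admissible data are then
ANTIholomorphic at `(ι, T)` (★ `F0P2tThetaOccursInGenNeg`: `θ = conjFun ∘ θ′ ∘ J`; ★ `mem_cohForms_comp_of_conj`); superseded by `sig_K2E2CapHolThetaWitnessOriented` (#12R) below.  DO NOT PROVE.**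
**sig CAP-1 (size L) — THE HOLOMORPHIC THETA WITNESS AT THE PINNED TRANSPORTS (the E2 letter of this line).**  TEL frame (`ι` the indefinite place,
`H` definite elsewhere, `[L⁺:ℚ] ≥ 2`, real diagonal frame `dV` via `g`, PINNED `ιA` and `ιV`, `[U(diag dV)]` compact), automorphic `μA`: for a conjugate-symplectic
`μ` of WEIGHT ONE and a line datum `(a, χ)` with `a·(2δ_L)⁻¹` ADMISSIBLE for `hμ.cmType`, there are a Weil-majorant witness, a finite invariant measure on
`[U(⟨a⟩)]`, a continuous weight `f` and a Schwartz–Bruhat `Φ` such that the class `[x ↦ Θ̃_Φ(f)(ιA x)] ∈ L²([U(H)], μA)` (i) is NON-ZERO and (ii) every discrete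
`P′` with `pr_{P′}[…] ≠ 0` is holomorphic-cotangent at `ι` AND has finite component `ω_H(μ, a, χ) = rhoAtLine …[e₁] ιV a χ`.  PLAN ∕ PROVENANCE: take
`f := charCM (chiQuot a χ)` and `Φ := φ⁰_∞ ⊗ Φ_f` (Gaussian of the holomorphic `K_∞`-type ⊗ a vector on which `ω_f` is seen): (i) = global theta
NON-VANISHING for coherent (= admissible, [Liu2021, Def. 4.12 ⟺ Prop. 4.13 «Conversely»]) data — ★ Θ-OCC-GEN `F0P2tThetaOccursInGenNeg.thetaOccursInGen`
(its `∃ e`-hypothesis is met by `e := a(2δ)⁻¹`, ★ `AdmissibleLine.epsOf_eq_locF_mk0`) read through ★ `F0LD1ThetaTransportKit` at the pinned `ιA`;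
(ii-hol) the archimedean theta lift of `φ⁰_∞` for weight-one admissible data is a HOLOMORPHIC cotangent form at `ι` ([Liu2021, App. D Lem. D.2 (2) ∕ proof of
Prop. 4.13 «`θ^{φ⁰}(φ) ∈ H⁰(Sh, Ω¹)`»]; [GelbartRogawski1991, §3.3–3.4]; Θ-OCC-GEN proves `∈ cohForms = hol ⊔ conj`; the ORIENTATION refinement `∈ holCotForms`
under admissibility w.r.t. `hμ.cmType` is this socket's one new archimedean point — FIRST RUNG for the prover) and ★ SP
`UnitaryGroupCotangentSpectralProjection.holCotFormSpectralProjection` (projections of holomorphic cotangent classes are holomorphic cotangent);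
(ii-fin) ★ NODE B′ `F0P2sNodeBPrimeHolds.hasFinComponent_rhoAtLine_three_of_starProjection_ne_zero_of_coe` at the pinned `ιV` (FRAME-1 for coherence).
Why it might fail: the hol ∕ antihol orientation of `θ^{φ⁰}` vs the convention `IsAdmissibleElement … (Im < 0)` — guarded: (C♯)hol ★ `F0P2qHdictEOfD1.cSharpHol_of_D1`
and E3♭ use the same convention, and [Rogawski1990, Thm. 13.3.6 (b)] pairs `ω_f` with exactly one archimedean member.
[cite: Liu2021, proof of Prop. 4.13 Case 1 (l. 2131–2137, p. 48) and «Conversely» (l. 2145–2149); App. D Lem. D.2 (`le:weil_arch`, l. 5279–5289, p. 127); Def. 4.12 (l. 2102–2108); App. B §B.2 (l. 4257–4262)]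
[cite: GelbartRogawski1991, §3.2 p. 457; Thm. 5.1.1 p. 465; Lem. 5.1.2 p. 466] [cite: Rallis1984, Thm. 1.2.2] [cite: Rogawski1990, Thm. 13.3.6]
audit: Liu21 FJcycle.tex L2140 «By Lemma \ref{le:weil_arch}, we know that μ is of weight one and ε_e is μ-admissible»; GR91 p466.txt L8–11 (Lem. 5.1.2; Remark
«(c) ⇒ (a) … without recourse to the Shimura integral») · size: L · deps: ★ Θ-OCC-GEN, ★ SP, ★ B′, ★ `F0LD1ThetaTransportKit`, FRAME-1 · unit: CAPTURE ·
tier-2 target `Theorems/K2E2CapHolThetaWitness.lean` -/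
theorem sig_K2E2CapHolThetaWitness :
    ∀ (L : Type) [Field L] [NumberField L] [IsCMField L] (ι : L →+* ℂ) (H : Matrix (Fin 3) (Fin 3) L) (T : GL (Fin 3) ℂ)
      (hT : (T : Matrix (Fin 3) (Fin 3) ℂ)ᴴ * H.map ι * (T : Matrix (Fin 3) (Fin 3) ℂ) = Literature.Geometry.ComplexHyperbolic.BallModel.J),
      (∀ τ' : L →+* ℂ, InfinitePlace.mk τ' ≠ InfinitePlace.mk ι → (H.map τ').PosDef) → 2 ≤ Module.finrank ℚ ↥(maximalRealSubfield L) →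
      ∀ {n' : ℕ} (e₁ : Fin 3 × Fin 1 ≃ Fin n') (dV : Fin 3 → L) (hdV : ∀ i, IsCMField.complexConj L (dV i) = dV i)
        (hdV0 : ∀ i, dV i ≠ 0) (g : GL (Fin 3) L)
        (hg : ((g : Matrix (Fin 3) (Fin 3) L).map (cmConjRingHom L))ᵀ * H * (g : Matrix (Fin 3) (Fin 3) L) = Matrix.diagonal dV)
        (ιA : (adelicGroupData (↥(maximalRealSubfield L)) L (IsCMField.complexConj L) 3 H).Adelic →*
            ↥(UnitaryGroup.adelic (↥(maximalRealSubfield L)) L (IsCMField.complexConj L) 3 (Matrix.diagonal dV))),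
          (∀ k, ((ιA k : ↥(UnitaryGroup.adelic (↥(maximalRealSubfield L)) L (IsCMField.complexConj L) 3 (Matrix.diagonal dV))) :
                GL (Fin 3) (AdeleRing (𝓞 L) L)) =
              (toAdeleGL L g)⁻¹ * adelicVal (↥(maximalRealSubfield L)) L (IsCMField.complexConj L) 3 H k * toAdeleGL L g) →
        ∀ (ιV : finAdelic (↥(maximalRealSubfield L)) L (IsCMField.complexConj L) 3 H →*
            finAdelic (↥(maximalRealSubfield L)) L (IsCMField.complexConj L) 3 (Matrix.diagonal dV)),
          (∀ k, ((ιV k : finAdelic (↥(maximalRealSubfield L)) L (IsCMField.complexConj L) 3 (Matrix.diagonal dV)) :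
              GL (Fin 3) (FiniteAdeleRing (𝓞 L) L)) =
            (toFinAdeleGL L 3 g)⁻¹ * (k : GL (Fin 3) (FiniteAdeleRing (𝓞 L) L)) * toFinAdeleGL L 3 g) →
        ∀ [CompactSpace (↥(UnitaryGroup.adelic (↥(maximalRealSubfield L)) L (IsCMField.complexConj L) 3 (Matrix.diagonal dV)) ⧸
            (UnitaryGroup.toAdelic (↥(maximalRealSubfield L)) L (IsCMField.complexConj L) 3 (Matrix.diagonal dV)).range)],
        ∀ (μA : Measure (adelicGroupData (↥(maximalRealSubfield L)) L (IsCMField.complexConj L) 3 H).automorphicQuotient)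
          [(adelicGroupData (↥(maximalRealSubfield L)) L (IsCMField.complexConj L) 3 H).IsAutomorphicMeasure μA]
          (μ : Literature.NumberTheory.Automorphic.IdeleClassGroup L →ₜ* Circle) (hμ : IsConjugateSymplectic L μ), HasWeight L μ 1 →
          ∀ (a : (↥(maximalRealSubfield L))ˣ) (χ : Chi (↥(maximalRealSubfield L)) L (IsCMField.complexConj L)),
            IsAdmissibleElement L hμ.cmType.1 (algebraMap (↥(maximalRealSubfield L)) L a * (2 * imagUnit L)⁻¹) →
            letI : MeasurableSpace (↥(UnitaryGroup.adelic (↥(maximalRealSubfield L)) L (IsCMField.complexConj L) 1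
                (JW (↥(maximalRealSubfield L)) L a)) ⧸
                  (UnitaryGroup.toAdelic (↥(maximalRealSubfield L)) L (IsCMField.complexConj L) 1 (JW (↥(maximalRealSubfield L)) L a)).range) :=
              borel _
            ∃ (hρ : HasThetaMajorants fun
                (p : ↥(UnitaryGroup.adelic (↥(maximalRealSubfield L)) L (IsCMField.complexConj L) 3 (Matrix.diagonal dV)) ×
                  ↥(UnitaryGroup.adelic (↥(maximalRealSubfield L)) L (IsCMField.complexConj L) 1 (JW (↥(maximalRealSubfield L)) L a)))
                (Φ : piSchwartzBruhat (↥(maximalRealSubfield L)) (Fin n')) =>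
                  pairRep (↥(maximalRealSubfield L)) L (IsCMField.complexConj L) 3 1 e₁ (Matrix.diagonal dV) (JW (↥(maximalRealSubfield L)) L a)
                    (chiSplittingLine L e₁ dV hdV hdV0 (toHeckeCharacter L μ) (isUnitary_toHeckeCharacter L μ)
                      ((isOscillatorChar_toHeckeCharacter_iff μ).mpr hμ) (TW (↥(maximalRealSubfield L)) a)
                      (isUnit_det_TW (↥(maximalRealSubfield L)) a) (JW (↥(maximalRealSubfield L)) L a) (JW_eq (↥(maximalRealSubfield L)) L a))
                    p Φ)
              (μW : Measure (↥(UnitaryGroup.adelic (↥(maximalRealSubfield L)) L (IsCMField.complexConj L) 1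
                (JW (↥(maximalRealSubfield L)) L a)) ⧸
                  (UnitaryGroup.toAdelic (↥(maximalRealSubfield L)) L (IsCMField.complexConj L) 1 (JW (↥(maximalRealSubfield L)) L a)).range))
              (_ : IsFiniteMeasure μW)
              (_ : SMulInvariantMeasure
                (↥(UnitaryGroup.adelic (↥(maximalRealSubfield L)) L (IsCMField.complexConj L) 1 (JW (↥(maximalRealSubfield L)) L a)))
                (↥(UnitaryGroup.adelic (↥(maximalRealSubfield L)) L (IsCMField.complexConj L) 1 (JW (↥(maximalRealSubfield L)) L a)) ⧸
                  (UnitaryGroup.toAdelic (↥(maximalRealSubfield L)) L (IsCMField.complexConj L) 1 (JW (↥(maximalRealSubfield L)) L a)).range)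
                μW)
              (f : C(↥(UnitaryGroup.adelic (↥(maximalRealSubfield L)) L (IsCMField.complexConj L) 1 (JW (↥(maximalRealSubfield L)) L a)) ⧸
                (UnitaryGroup.toAdelic (↥(maximalRealSubfield L)) L (IsCMField.complexConj L) 1 (JW (↥(maximalRealSubfield L)) L a)).range, ℂ))
              (Φ : piSchwartzBruhat (↥(maximalRealSubfield L)) (Fin n'))
              (hθ : MemLp (toQuotFun (adelicGroupData (↥(maximalRealSubfield L)) L (IsCMField.complexConj L) 3 H) fun x =>
                (lineThetaKernelDatum L 3 e₁ dV hdV hdV0 μ hμ a hρ).thetaLiftFun μW Φ f (ιA x)) 2 μA),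
              MemLp.toLp _ hθ ≠ 0 ∧
              ∀ P' : DiscreteAutomorphicRep (adelicGroupData (↥(maximalRealSubfield L)) L (IsCMField.complexConj L) 3 H) μA,
                P'.space.toSubmodule.starProjection (MemLp.toLp _ hθ) ≠ 0 →
                P'.IsHolCotangentAt (cmArchSection L ι H T hT) (cmCompactFactor L ι H T hT) ∧
                P'.HasFinComponent
                  (rhoAtLine (↥(maximalRealSubfield L)) L (IsCMField.complexConj L) 3 e₁ (Matrix.diagonal dV)
                    (complexConj_imagUnit L) (imagUnit_ne_zero L) (imagUnit_mul_self L) (realDiagonal_isSymm L dV hdV)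
                    (isUnit_det_realDiagonal L dV hdV hdV0) (realDiagonal_map L dV hdV).symm
                    (fun a => isCompatible_chiSplittingLine L e₁ dV hdV hdV0 (toHeckeCharacter L μ)
                      (isUnitary_toHeckeCharacter L μ) ((isOscillatorChar_toHeckeCharacter_iff μ).mpr hμ)
                      (TW (↥(maximalRealSubfield L)) a) (isSymm_TW (↥(maximalRealSubfield L)) a)
                      (isUnit_det_TW (↥(maximalRealSubfield L)) a) (JW (↥(maximalRealSubfield L)) L a)
                      (JW_eq (↥(maximalRealSubfield L)) L a)) ιV a χ) := by
  sorry

section ArchRowsGen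
open scoped Classical
open MulAction
open Literature.Geometry.ComplexHyperbolic.BallModel (U21 x₀)
open Literature.AlgebraicGeometry.ShimuraVarieties (BallForms.isPullbackCocycle_cotangentCocycle)
open Summit.HodgeConjecture.HodgeConjecture.Cruxes.H413

set_option synthInstance.maxHeartbeats 400000 in
set_option maxHeartbeats 16000000 in
/-- **sig ARCH-PAIR-HOLCOT `sig_K2E2CapArchPairHolCot` (#20a; ★ CLOSED BY NAME in ED. 6 (2026-09-04T03:52Z) `:= @Summit.HodgeConjecture.HodgeConjecture.Cruxes.H413.K2E2CapArchPairHolCot.capArchPairHolCot` — ★ p857161, K2E2-p12 (g2); bytes FROZEN since ED. 5; size L–XL; THE OPEN E2-OWN LEAF of the line; line lead K2E2-p12) = the hypothesis `hP` of ★ p855623 `K2E2CapArchPairHolCot.archRowsAllData_of_pairHolCot` VERBATIM (bytes = K2E2-p12's `ARCH-PAIR-HOLCOT.txt`, ws-sha16 3efc5e019e17f8df).**  At every TEL frame `(L, ι, H, T, hT, e₁, dV, g, hg, ιV, hιV)` with `ι ∈ hμ.cmType.1`, weight-one conjugate-symplectic `μ`, `a(2δ)⁻¹` `Φ_μ`-admissible,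 `χ`, and for ALL theta data `(hρ, μ_W)` (majorants, a finite `U(W_a)(𝔸)`-invariant open-positive Borel measure on `[U(W_a)]`): there is a PAIR of archimedean Schwartz functions `φ : Fin 2 → 𝓢((Fin 3 × Fin 1) → mixedSpace L⁺, ℂ)` and an index `j₀` with (HOLCOT) for every finite datum `Φ_f` the theta pair `x ↦ (j ↦ Θ_{φ_j ⊗ Φ_f}(χ̃_χ)(cmAdelicFrameTransport x))` lies in `holCotForms L⁺ L c 3 H (cmArchSection ι T) (cmCompactFactor ι T)` (holomorphic cotangent forms at `(ι, T)`), `R^∞_{e₁} φ_{j₀} ≠ 0`, and (E) `R^∞_{e₁} φ_{j₀}` is FIXED by `U(⟨a⟩)(L⁺ ⊗ ℝ)` under the archimedean Weil representation at the `μ`-splitting.  This is ARCH-ROWS-GEN with the three analytic rows (W)(K)(H) of ★ B⁗ FOLDED into the single membership conclusion of ★ B⁗ (so the closer may EITHER prove the rows and apply ★ `F0P2sThetaPairsCotForms.thetaPair_mem_holCotForms_of_arch`, OR transport the P4-engine's model-currency membership ★ `harm_cDiag_of_CC` ∕ `hdef_cDiag_of_CC` ∕ `archLineInputAt` through a function-level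 kernel identity H1 `Theorems/K2E2CapArchKernelIdentity.lean` + membership transport H2 `Theorems/K2E2CapArchMembershipTransport.lean` (★ `F0P2sThetaOccursInArchTransport.exists_linear_frameTransport_from_pin`), with (E)+`≠ 0` from H3 `Theorems/K2E2CapArchPairFixedNeZero.lean` (★ `archWeilRep_one_line_eq_self_of_center`, ★ `cmArchWeilRep_one_blockFamilyOfAt_eq_inv_twistChar_smul`)).  In print: [KonnoKonno2007, Thm. 5.4] (the harmonic Gaussian pair of the U(2,1)×U(1) theta correspondence), [Liu2021, App. D Lem. D.2 (2), §D.1 Step 3] (archimedean theta lifts of admissible data are holomorphic cotangent), [GelbartRogawski1991, §3 (3.2)–(3.4)].  HONEST: this socket carries the ENTIRE open E2-own content of #12R ∕ #20 (★ p855353, ★ p855525, ★ p855623 pay the assembly only); HC_CM count unchanged.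
Why it might fail: none known in print (it IS Lem. D.2 (2) + Thm. 5.4); typing risks = (R8) a surviving archimedean `det`-twist `c(·,1)_∞` of the splitting character at non-canonical `ι` in the kernel identity H1 (K2E2-p12 ADDENDUM 1 — to be reported BEFORE closer bytes), and the sign ∕ normalisation of `mixedSpace` Gaussians at the frame `dV`.
[cite: KonnoKonno2007, Thm. 5.4 p. 75] [cite: Liu2021, App. D Lem. D.2 (2) (l. 5279–5289); §D.1 Step 3] [cite: GelbartRogawski1991, §3 (3.2)–(3.4) p. 457] [cite: Rallis1984, Thm. 1.2.2]
size: L–XL · deps: ★ P4 engine model rows, ★ B⁗, ★ `F0P2sThetaOccursInArchTransport`, helpers H1–H3 (Theorems level, names reserved) · unit: CAPTURE · holder: K2E2-p12 (line lead) · tier-2 target `Theorems/K2E2CapArchPairHolCot.lean` -/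
theorem sig_K2E2CapArchPairHolCot :
      ∀ (L : Type) [Field L] [NumberField L] [IsCMField L] (ι : L →+* ℂ) (H : Matrix (Fin 3) (Fin 3) L) (T : GL (Fin 3) ℂ)
        (hT : (T : Matrix (Fin 3) (Fin 3) ℂ)ᴴ * H.map ι * (T : Matrix (Fin 3) (Fin 3) ℂ) = Literature.Geometry.ComplexHyperbolic.BallModel.J),
        (∀ τ' : L →+* ℂ, InfinitePlace.mk τ' ≠ InfinitePlace.mk ι → (H.map τ').PosDef) → 2 ≤ Module.finrank ℚ ↥(maximalRealSubfield L) →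
        ∀ {n' : ℕ} (e₁ : Fin 3 × Fin 1 ≃ Fin n') (dV : Fin 3 → L) (hdV : ∀ i, IsCMField.complexConj L (dV i) = dV i)
          (hdV0 : ∀ i, dV i ≠ 0) (g : GL (Fin 3) L)
          (hg : ((g : Matrix (Fin 3) (Fin 3) L).map (cmConjRingHom L))ᵀ * H * (g : Matrix (Fin 3) (Fin 3) L) = Matrix.diagonal dV)
          (ιV : finAdelic (↥(maximalRealSubfield L)) L (IsCMField.complexConj L) 3 H →*
              finAdelic (↥(maximalRealSubfield L)) L (IsCMField.complexConj L) 3 (Matrix.diagonal dV)),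
            (∀ k, ((ιV k : finAdelic (↥(maximalRealSubfield L)) L (IsCMField.complexConj L) 3 (Matrix.diagonal dV)) :
                GL (Fin 3) (FiniteAdeleRing (𝓞 L) L)) =
              (toFinAdeleGL L 3 g)⁻¹ * (k : GL (Fin 3) (FiniteAdeleRing (𝓞 L) L)) * toFinAdeleGL L 3 g) →
          ∀ [CompactSpace (↥(UnitaryGroup.adelic (↥(maximalRealSubfield L)) L (IsCMField.complexConj L) 3 (Matrix.diagonal dV)) ⧸
              (UnitaryGroup.toAdelic (↥(maximalRealSubfield L)) L (IsCMField.complexConj L) 3 (Matrix.diagonal dV)).range)],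
          ∀ (μ : Literature.NumberTheory.Automorphic.IdeleClassGroup L →ₜ* Circle) (hμ : IsConjugateSymplectic L μ), HasWeight L μ 1 →
            ι ∈ hμ.cmType.1 →
          ∀ (a : (↥(maximalRealSubfield L))ˣ) (χ : Chi (↥(maximalRealSubfield L)) L (IsCMField.complexConj L)),
              IsAdmissibleElement L hμ.cmType.1 (algebraMap (↥(maximalRealSubfield L)) L a * (2 * imagUnit L)⁻¹) →
              ∀ (hρ : HasThetaMajorants fun
                  (p : ↥(UnitaryGroup.adelic (↥(maximalRealSubfield L)) L (IsCMField.complexConj L) 3 (Matrix.diagonal dV)) ×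
                    ↥(UnitaryGroup.adelic (↥(maximalRealSubfield L)) L (IsCMField.complexConj L) 1 (JW (↥(maximalRealSubfield L)) L a)))
                  (Φ : piSchwartzBruhat (↥(maximalRealSubfield L)) (Fin n')) =>
                    pairRep (↥(maximalRealSubfield L)) L (IsCMField.complexConj L) 3 1 e₁ (Matrix.diagonal dV) (JW (↥(maximalRealSubfield L)) L a)
                      (chiSplittingLine L e₁ dV hdV hdV0 (toHeckeCharacter L μ) (isUnitary_toHeckeCharacter L μ)
                        ((isOscillatorChar_toHeckeCharacter_iff μ).mpr hμ) (TW (↥(maximalRealSubfield L)) a)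
                        (isUnit_det_TW (↥(maximalRealSubfield L)) a) (JW (↥(maximalRealSubfield L)) L a) (JW_eq (↥(maximalRealSubfield L)) L a))
                      p Φ)
                [MeasurableSpace (↥(UnitaryGroup.adelic (↥(maximalRealSubfield L)) L (IsCMField.complexConj L) 1
                    (JW (↥(maximalRealSubfield L)) L a)) ⧸
                      (UnitaryGroup.toAdelic (↥(maximalRealSubfield L)) L (IsCMField.complexConj L) 1 (JW (↥(maximalRealSubfield L)) L a)).range)]
                [BorelSpace (↥(UnitaryGroup.adelic (↥(maximalRealSubfield L)) L (IsCMField.complexConj L) 1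
                    (JW (↥(maximalRealSubfield L)) L a)) ⧸
                      (UnitaryGroup.toAdelic (↥(maximalRealSubfield L)) L (IsCMField.complexConj L) 1 (JW (↥(maximalRealSubfield L)) L a)).range)]
                (μW : Measure (↥(UnitaryGroup.adelic (↥(maximalRealSubfield L)) L (IsCMField.complexConj L) 1
                  (JW (↥(maximalRealSubfield L)) L a)) ⧸
                    (UnitaryGroup.toAdelic (↥(maximalRealSubfield L)) L (IsCMField.complexConj L) 1 (JW (↥(maximalRealSubfield L)) L a)).range))
                [IsFiniteMeasure μW]
                [SMulInvariantMeasure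
                  (↥(UnitaryGroup.adelic (↥(maximalRealSubfield L)) L (IsCMField.complexConj L) 1 (JW (↥(maximalRealSubfield L)) L a)))
                  (↥(UnitaryGroup.adelic (↥(maximalRealSubfield L)) L (IsCMField.complexConj L) 1 (JW (↥(maximalRealSubfield L)) L a)) ⧸
                    (UnitaryGroup.toAdelic (↥(maximalRealSubfield L)) L (IsCMField.complexConj L) 1 (JW (↥(maximalRealSubfield L)) L a)).range)
                  μW]
                [μW.IsOpenPosMeasure],
              ∃ (φ : Fin 2 → 𝓢(((Fin 3 × Fin 1) → NumberField.mixedEmbedding.mixedSpace ↥(maximalRealSubfield L)), ℂ)) (j₀ : Fin 2),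
                  -- (HOLCOT) every theta pair of `φ` read on `U(H)(𝔸)` along the canonical transport is a HOLOMORPHIC COTANGENT FORM at `(ι, T)` …
                (haveI := normal_range_toAdelic_JW L a
                 ∀ (Φf : FinSB (↥(maximalRealSubfield L)) (Fin 3 × Fin 1)),
                    ((fun (x : (adelicGroupData (↥(maximalRealSubfield L)) L (IsCMField.complexConj L) 3 H).Adelic) (j : Fin 2) =>
                      (lineThetaKernelDatum L 3 e₁ dV hdV hdV0 μ hμ a hρ).thetaLiftFun μW
                        (piSBReindex (↥(maximalRealSubfield L)) e₁
                          (piSchwartzBruhatEquiv (↥(maximalRealSubfield L)) (Fin 3 × Fin 1) (φ j ⊗ₜ[ℂ] Φf)))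
                        (charCM (chiQuot (↥(maximalRealSubfield L)) L (IsCMField.complexConj L) (Algebra.IsQuadraticExtension.finrank_eq_two _ L)
                          (IsCMField.complexConj_ne_one (K := L)) a χ))
                        ((cmAdelicFrameTransport L 3 H dV g hg) x))) ∈
                      CotangentForms.holCotForms (↥(maximalRealSubfield L)) L (IsCMField.complexConj L) 3 H
                        (cmArchSection L ι H T hT) (cmCompactFactor L ι H T hT)) ∧
                  -- … the archimedean vector `R^∞_{e₁} φ_{j₀}` is non-zero …
                schwartzReindexCLM (↥(maximalRealSubfield L)) e₁ (φ j₀) ≠ 0 ∧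
                  -- (E) … and FIXED by `U(⟨a⟩)(L⁺ ⊗ ℝ)` under the archimedean Weil representation at the `μ`-splitting
                (∀ a' : UnitaryGroup.arch (↥(maximalRealSubfield L)) L (IsCMField.complexConj L) 1 (JW (↥(maximalRealSubfield L)) L a),
                  HodgeCM.Model.HypCensus.archWeilRep (↥(maximalRealSubfield L)) L (IsCMField.complexConj L) 3 1 (Matrix.diagonal dV)
                    (JW (↥(maximalRealSubfield L)) L a) (complexConj_imagUnit L) (imagUnit_ne_zero L) (imagUnit_mul_self L) (realDiagonal_isSymm L dV hdV)
                    (isSymm_TW (↥(maximalRealSubfield L)) a) (isUnit_det_realDiagonal L dV hdV hdV0) (isUnit_det_TW (↥(maximalRealSubfield L)) a)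
                    (realDiagonal_map L dV hdV).symm (JW_eq (↥(maximalRealSubfield L)) L a) e₁
                    (chiSplittingLine L e₁ dV hdV hdV0 (toHeckeCharacter L μ) (isUnitary_toHeckeCharacter L μ)
                      ((isOscillatorChar_toHeckeCharacter_iff μ).mpr hμ) (TW (↥(maximalRealSubfield L)) a)
                      (isUnit_det_TW (↥(maximalRealSubfield L)) a) (JW (↥(maximalRealSubfield L)) L a) (JW_eq (↥(maximalRealSubfield L)) L a))
                    (ThetaNonvanishing.proj_apply_eq_toSp (↥(maximalRealSubfield L)) L (IsCMField.complexConj L) 3 1 e₁ (Matrix.diagonal dV)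
                      (JW (↥(maximalRealSubfield L)) L a) (complexConj_imagUnit L) (imagUnit_ne_zero L) (imagUnit_mul_self L) (realDiagonal_isSymm L dV hdV)
                      (isSymm_TW (↥(maximalRealSubfield L)) a) (isUnit_det_realDiagonal L dV hdV hdV0) (isUnit_det_TW (↥(maximalRealSubfield L)) a)
                      (realDiagonal_map L dV hdV).symm (JW_eq (↥(maximalRealSubfield L)) L a)
                      (isCompatible_chiSplittingLine L e₁ dV hdV hdV0 (toHeckeCharacter L μ) (isUnitary_toHeckeCharacter L μ)
                        ((isOscillatorChar_toHeckeCharacter_iff μ).mpr hμ) (TW (↥(maximalRealSubfield L)) a) (isSymm_TW (↥(maximalRealSubfield L)) a)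
                        (isUnit_det_TW (↥(maximalRealSubfield L)) a) (JW (↥(maximalRealSubfield L)) L a) (JW_eq (↥(maximalRealSubfield L)) L a)))
                    (1, a') (schwartzReindexCLM (↥(maximalRealSubfield L)) e₁ (φ j₀)) = schwartzReindexCLM (↥(maximalRealSubfield L)) e₁ (φ j₀)) :=
  @Summit.HodgeConjecture.HodgeConjecture.Cruxes.H413.K2E2CapArchPairHolCot.capArchPairHolCot

set_option synthInstance.maxHeartbeats 400000 in
set_option maxHeartbeats 16000000 in
/-- **sig ARCH-ROWS-GEN `sig_K2E2CapArchRowsGen` (#20, ED. 5; ED. 6: #20a is ★ p857161 ⇒ this socket is now ★ OUTRIGHT through ★ names; was CLOSED RELATIVE to #20a `sig_K2E2CapArchPairHolCot` by ★ p855525 `K2E2CapArchRowsGen.archRowsGen_of_forall_thetaData` ∘ ★ p855623 `K2E2CapArchPairHolCot.archRowsAllData_of_pairHolCot` — R14: statement bytes FROZEN, one road; size XL as a direct target, superseded as booking candidate by #20a) = the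
hypothesis `hA` of ★ p855353 `K2E2CapHolThetaWitnessOriented.capHolThetaWitnessOriented_of_archRowsGen` VERBATIM (K2E2-p12 22:45:28Z; bytes = p12's
`StubArchRowsGen.cand.lean` 3cf401677f2367a6 def body).**  At every TEL frame with `ι ∈ hμ.cmType.1`, weight-one `μ`, `a(2δ)⁻¹` `Φ_μ`-admissible, `χ`: there are
theta majorants `hρ`, a finite invariant open-positive Borel measure `μ_W` on `[U(W_a)]`, a PAIR of Gaussian Schwartz functions `φ : Fin 2 → 𝓢((Fin 3 × Fin 1) → mixedSpace L⁺)`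
and an index `j₀` such that (W) (K) (H) — the binders `hW hK hH` of ★ B⁗ `F0P2sThetaPairsCotForms.thetaPair_mem_holCotForms_of_arch` (harmonicity ∕ `K_∞`-type ∕
holomorphy rows at every `Φ_f`) — hold, `R^∞_{e₁} φ_{j₀} ≠ 0`, and (E) — the binders `hΦ hE` of ★ (N5) `F0P2tThetaPairNeZeroOfFrame.thetaPair_ne_zero_of_archFixed_frame`
(archimedean fixed vector under `U(W_a)(ℝ)`).  In print: [KonnoKonno2007, Thm. 5.4] (harmonic Gaussian of the U(2,1)×U(1) theta pair), [Liu2021, App. D Lem. D.2 (2),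
§D.1 Step 3].  In tree ONLY in MODEL currency inside the P4 engine (★ `harm_cDiag_of_CC` ∕ `hdef_cDiag_of_CC` ∕ `archLineInputAt` at `cDiag Φ σ a` ∕ `frameD V`,
canonical `ι`; no function-level model → `lineThetaKernelDatum` bridge, no function-level frame transport of PAIRS, no `c̄`-twist for non-canonical `ι` — p12 census
21:36:47Z (3)).  HONEST: this socket carries #12R's ENTIRE open content; ★ p855353 pays the assembly (N5) ▸ B⁗ ▸ (β) only.
Why it might fail: none known in print (it IS Lem. D.2 (2)); the typing risk is the generic-frame currency (sign ∕ normalisation of `mixedSpace` Gaussians at `dV`).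
[cite: KonnoKonno2007, Thm. 5.4] [cite: Liu2021, App. D Lem. D.2 (2) (l. 5279–5289); §D.1 Step 3] [cite: GelbartRogawski1991, §3 (3.2)–(3.4)] [cite: Rallis1984, Thm. 1.2.2]
size: XL (booking candidate) · deps: ★ P4 engine model rows, ★ (N5), ★ B⁗ · unit: CAPTURE · holder: K2E2-p12 (or tier −1 named input if the chair books it) ·
tier-2 target `Theorems/K2E2CapArchRowsGen.lean` -/
theorem sig_K2E2CapArchRowsGen :
      ∀ (L : Type) [Field L] [NumberField L] [IsCMField L] (ι : L →+* ℂ) (H : Matrix (Fin 3) (Fin 3) L) (T : GL (Fin 3) ℂ)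
        (hT : (T : Matrix (Fin 3) (Fin 3) ℂ)ᴴ * H.map ι * (T : Matrix (Fin 3) (Fin 3) ℂ) = Literature.Geometry.ComplexHyperbolic.BallModel.J),
        (∀ τ' : L →+* ℂ, InfinitePlace.mk τ' ≠ InfinitePlace.mk ι → (H.map τ').PosDef) → 2 ≤ Module.finrank ℚ ↥(maximalRealSubfield L) →
        ∀ {n' : ℕ} (e₁ : Fin 3 × Fin 1 ≃ Fin n') (dV : Fin 3 → L) (hdV : ∀ i, IsCMField.complexConj L (dV i) = dV i)
          (hdV0 : ∀ i, dV i ≠ 0) (g : GL (Fin 3) L)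
          (hg : ((g : Matrix (Fin 3) (Fin 3) L).map (cmConjRingHom L))ᵀ * H * (g : Matrix (Fin 3) (Fin 3) L) = Matrix.diagonal dV)
          (ιV : finAdelic (↥(maximalRealSubfield L)) L (IsCMField.complexConj L) 3 H →*
              finAdelic (↥(maximalRealSubfield L)) L (IsCMField.complexConj L) 3 (Matrix.diagonal dV)),
            (∀ k, ((ιV k : finAdelic (↥(maximalRealSubfield L)) L (IsCMField.complexConj L) 3 (Matrix.diagonal dV)) :
                GL (Fin 3) (FiniteAdeleRing (𝓞 L) L)) =
              (toFinAdeleGL L 3 g)⁻¹ * (k : GL (Fin 3) (FiniteAdeleRing (𝓞 L) L)) * toFinAdeleGL L 3 g) →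
          ∀ [CompactSpace (↥(UnitaryGroup.adelic (↥(maximalRealSubfield L)) L (IsCMField.complexConj L) 3 (Matrix.diagonal dV)) ⧸
              (UnitaryGroup.toAdelic (↥(maximalRealSubfield L)) L (IsCMField.complexConj L) 3 (Matrix.diagonal dV)).range)],
          ∀ (μ : Literature.NumberTheory.Automorphic.IdeleClassGroup L →ₜ* Circle) (hμ : IsConjugateSymplectic L μ), HasWeight L μ 1 →
            ι ∈ hμ.cmType.1 →
          ∀ (a : (↥(maximalRealSubfield L))ˣ) (χ : Chi (↥(maximalRealSubfield L)) L (IsCMField.complexConj L)),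
              IsAdmissibleElement L hμ.cmType.1 (algebraMap (↥(maximalRealSubfield L)) L a * (2 * imagUnit L)⁻¹) →
              letI : MeasurableSpace (↥(UnitaryGroup.adelic (↥(maximalRealSubfield L)) L (IsCMField.complexConj L) 1
                  (JW (↥(maximalRealSubfield L)) L a)) ⧸
                    (UnitaryGroup.toAdelic (↥(maximalRealSubfield L)) L (IsCMField.complexConj L) 1 (JW (↥(maximalRealSubfield L)) L a)).range) :=
                borel _
              ∃ (hρ : HasThetaMajorants fun
                  (p : ↥(UnitaryGroup.adelic (↥(maximalRealSubfield L)) L (IsCMField.complexConj L) 3 (Matrix.diagonal dV)) ×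
                    ↥(UnitaryGroup.adelic (↥(maximalRealSubfield L)) L (IsCMField.complexConj L) 1 (JW (↥(maximalRealSubfield L)) L a)))
                  (Φ : piSchwartzBruhat (↥(maximalRealSubfield L)) (Fin n')) =>
                    pairRep (↥(maximalRealSubfield L)) L (IsCMField.complexConj L) 3 1 e₁ (Matrix.diagonal dV) (JW (↥(maximalRealSubfield L)) L a)
                      (chiSplittingLine L e₁ dV hdV hdV0 (toHeckeCharacter L μ) (isUnitary_toHeckeCharacter L μ)
                        ((isOscillatorChar_toHeckeCharacter_iff μ).mpr hμ) (TW (↥(maximalRealSubfield L)) a)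
                        (isUnit_det_TW (↥(maximalRealSubfield L)) a) (JW (↥(maximalRealSubfield L)) L a) (JW_eq (↥(maximalRealSubfield L)) L a))
                      p Φ)
                (μW : Measure (↥(UnitaryGroup.adelic (↥(maximalRealSubfield L)) L (IsCMField.complexConj L) 1
                  (JW (↥(maximalRealSubfield L)) L a)) ⧸
                    (UnitaryGroup.toAdelic (↥(maximalRealSubfield L)) L (IsCMField.complexConj L) 1 (JW (↥(maximalRealSubfield L)) L a)).range))
                (_ : IsFiniteMeasure μW)
                (_ : SMulInvariantMeasure
                  (↥(UnitaryGroup.adelic (↥(maximalRealSubfield L)) L (IsCMField.complexConj L) 1 (JW (↥(maximalRealSubfield L)) L a)))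
                  (↥(UnitaryGroup.adelic (↥(maximalRealSubfield L)) L (IsCMField.complexConj L) 1 (JW (↥(maximalRealSubfield L)) L a)) ⧸
                    (UnitaryGroup.toAdelic (↥(maximalRealSubfield L)) L (IsCMField.complexConj L) 1 (JW (↥(maximalRealSubfield L)) L a)).range)
                  μW)
                (_ : μW.IsOpenPosMeasure)
                (φ : Fin 2 → 𝓢(((Fin 3 × Fin 1) → NumberField.mixedEmbedding.mixedSpace ↥(maximalRealSubfield L)), ℂ)) (j₀ : Fin 2),
                -- the rows (W) ∧ (K) ∧ (H) ∧ (R^∞φ_{j₀} ≠ 0) ∧ (E):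
                -- (W) the cotangent `K_∞`-type along `cmArchSection`
                (haveI := normal_range_toAdelic_JW L a
                 ∀ (Φf : FinSB (↥(maximalRealSubfield L)) (Fin 3 × Fin 1)) (k : ↥(stabilizer (↥U21) x₀))
                    (x : (adelicGroupData (↥(maximalRealSubfield L)) L (IsCMField.complexConj L) 3 H).Adelic),
                    (fun (j : Fin 2) =>
                      (lineThetaKernelDatum L 3 e₁ dV hdV hdV0 μ hμ a hρ).thetaLiftFun μW
                        (piSBReindex (↥(maximalRealSubfield L)) e₁
                          (piSchwartzBruhatEquiv (↥(maximalRealSubfield L)) (Fin 3 × Fin 1) (φ j ⊗ₜ[ℂ] Φf)))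
                        (charCM (chiQuot (↥(maximalRealSubfield L)) L (IsCMField.complexConj L) (Algebra.IsQuadraticExtension.finrank_eq_two _ L)
                          (IsCMField.complexConj_ne_one (K := L)) a χ))
                        ((cmAdelicFrameTransport L 3 H dV g hg) (x * ((cmArchSection L ι H T hT).comp (stabilizer (↥U21) x₀).subtype) k))) =
                      (BallForms.isPullbackCocycle_cotangentCocycle.weightOf x₀) k⁻¹ ((fun (j : Fin 2) =>
                      (lineThetaKernelDatum L 3 e₁ dV hdV hdV0 μ hμ a hρ).thetaLiftFun μW
                        (piSBReindex (↥(maximalRealSubfield L)) e₁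
                          (piSchwartzBruhatEquiv (↥(maximalRealSubfield L)) (Fin 3 × Fin 1) (φ j ⊗ₜ[ℂ] Φf)))
                        (charCM (chiQuot (↥(maximalRealSubfield L)) L (IsCMField.complexConj L) (Algebra.IsQuadraticExtension.finrank_eq_two _ L)
                          (IsCMField.complexConj_ne_one (K := L)) a χ))
                        ((cmAdelicFrameTransport L 3 H dV g hg) x)))) ∧
                -- (K) invariance under the compact archimedean factor
                (haveI := normal_range_toAdelic_JW L a
                 ∀ (Φf : FinSB (↥(maximalRealSubfield L)) (Fin 3 × Fin 1)), ∀ k ∈ cmCompactFactor L ι H T hT,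
                    ∀ (x : (adelicGroupData (↥(maximalRealSubfield L)) L (IsCMField.complexConj L) 3 H).Adelic),
                    (fun (j : Fin 2) =>
                      (lineThetaKernelDatum L 3 e₁ dV hdV hdV0 μ hμ a hρ).thetaLiftFun μW
                        (piSBReindex (↥(maximalRealSubfield L)) e₁
                          (piSchwartzBruhatEquiv (↥(maximalRealSubfield L)) (Fin 3 × Fin 1) (φ j ⊗ₜ[ℂ] Φf)))
                        (charCM (chiQuot (↥(maximalRealSubfield L)) L (IsCMField.complexConj L) (Algebra.IsQuadraticExtension.finrank_eq_two _ L)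
                          (IsCMField.complexConj_ne_one (K := L)) a χ))
                        ((cmAdelicFrameTransport L 3 H dV g hg) (x * k))) = (fun (j : Fin 2) =>
                      (lineThetaKernelDatum L 3 e₁ dV hdV hdV0 μ hμ a hρ).thetaLiftFun μW
                        (piSBReindex (↥(maximalRealSubfield L)) e₁
                          (piSchwartzBruhatEquiv (↥(maximalRealSubfield L)) (Fin 3 × Fin 1) (φ j ⊗ₜ[ℂ] Φf)))
                        (charCM (chiQuot (↥(maximalRealSubfield L)) L (IsCMField.complexConj L) (Algebra.IsQuadraticExtension.finrank_eq_two _ L)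
                          (IsCMField.complexConj_ne_one (K := L)) a χ))
                        ((cmAdelicFrameTransport L 3 H dV g hg) x))) ∧
                -- (H) holomorphic germs along `cmArchSection`
                (haveI := normal_range_toAdelic_JW L a
                 ∀ (Φf : FinSB (↥(maximalRealSubfield L)) (Fin 3 × Fin 1)),
                    IsHolGerm (cmArchSection L ι H T hT) ((fun (x : (adelicGroupData (↥(maximalRealSubfield L)) L (IsCMField.complexConj L) 3 H).Adelic) (j : Fin 2) =>
                      (lineThetaKernelDatum L 3 e₁ dV hdV hdV0 μ hμ a hρ).thetaLiftFun μW
                        (piSBReindex (↥(maximalRealSubfield L)) e₁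
                          (piSchwartzBruhatEquiv (↥(maximalRealSubfield L)) (Fin 3 × Fin 1) (φ j ⊗ₜ[ℂ] Φf)))
                        (charCM (chiQuot (↥(maximalRealSubfield L)) L (IsCMField.complexConj L) (Algebra.IsQuadraticExtension.finrank_eq_two _ L)
                          (IsCMField.complexConj_ne_one (K := L)) a χ))
                        ((cmAdelicFrameTransport L 3 H dV g hg) x)))) ∧
                -- the archimedean vector `R^∞_{e₁} φ_{j₀}` is non-zero …
                schwartzReindexCLM (↥(maximalRealSubfield L)) e₁ (φ j₀) ≠ 0 ∧
                -- (E) … and FIXED by `U(⟨a⟩)(L⁺ ⊗ ℝ)` under the archimedean Weil representation at the `μ`-splitting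
                (∀ a' : UnitaryGroup.arch (↥(maximalRealSubfield L)) L (IsCMField.complexConj L) 1 (JW (↥(maximalRealSubfield L)) L a),
                  HodgeCM.Model.HypCensus.archWeilRep (↥(maximalRealSubfield L)) L (IsCMField.complexConj L) 3 1 (Matrix.diagonal dV)
                    (JW (↥(maximalRealSubfield L)) L a) (complexConj_imagUnit L) (imagUnit_ne_zero L) (imagUnit_mul_self L) (realDiagonal_isSymm L dV hdV)
                    (isSymm_TW (↥(maximalRealSubfield L)) a) (isUnit_det_realDiagonal L dV hdV hdV0) (isUnit_det_TW (↥(maximalRealSubfield L)) a)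
                    (realDiagonal_map L dV hdV).symm (JW_eq (↥(maximalRealSubfield L)) L a) e₁
                    (chiSplittingLine L e₁ dV hdV hdV0 (toHeckeCharacter L μ) (isUnitary_toHeckeCharacter L μ)
                      ((isOscillatorChar_toHeckeCharacter_iff μ).mpr hμ) (TW (↥(maximalRealSubfield L)) a)
                      (isUnit_det_TW (↥(maximalRealSubfield L)) a) (JW (↥(maximalRealSubfield L)) L a) (JW_eq (↥(maximalRealSubfield L)) L a))
                    (ThetaNonvanishing.proj_apply_eq_toSp (↥(maximalRealSubfield L)) L (IsCMField.complexConj L) 3 1 e₁ (Matrix.diagonal dV)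
                      (JW (↥(maximalRealSubfield L)) L a) (complexConj_imagUnit L) (imagUnit_ne_zero L) (imagUnit_mul_self L) (realDiagonal_isSymm L dV hdV)
                      (isSymm_TW (↥(maximalRealSubfield L)) a) (isUnit_det_realDiagonal L dV hdV hdV0) (isUnit_det_TW (↥(maximalRealSubfield L)) a)
                      (realDiagonal_map L dV hdV).symm (JW_eq (↥(maximalRealSubfield L)) L a)
                      (isCompatible_chiSplittingLine L e₁ dV hdV hdV0 (toHeckeCharacter L μ) (isUnitary_toHeckeCharacter L μ)
                        ((isOscillatorChar_toHeckeCharacter_iff μ).mpr hμ) (TW (↥(maximalRealSubfield L)) a) (isSymm_TW (↥(maximalRealSubfield L)) a)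
                        (isUnit_det_TW (↥(maximalRealSubfield L)) a) (JW (↥(maximalRealSubfield L)) L a) (JW_eq (↥(maximalRealSubfield L)) L a)))
                    (1, a') (schwartzReindexCLM (↥(maximalRealSubfield L)) e₁ (φ j₀)) = schwartzReindexCLM (↥(maximalRealSubfield L)) e₁ (φ j₀))
    :=
  @Summit.HodgeConjecture.HodgeConjecture.Cruxes.H413.K2E2CapArchRowsGen.archRowsGen_of_forall_thetaData
    (@Summit.HodgeConjecture.HodgeConjecture.Cruxes.H413.K2E2CapArchPairHolCot.archRowsAllData_of_pairHolCot
      sig_K2E2CapArchPairHolCot)  -- ★ RE-TIED MODULO #20a (p855525 ∘ p855623, K2E2-p12; statement bytes above FROZEN)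

end ArchRowsGen

set_option synthInstance.maxHeartbeats 400000 in
set_option maxHeartbeats 16000000 in
/-- **sig CAP-1R `sig_K2E2CapHolThetaWitnessOriented` (#12R, size L; SUPERSEDES the withdrawn #12) = #12 + ONE binder `ι ∈ hμ.cmType.1` after `HasWeight L μ 1`.**
POSITIVELY ORIENTED admissible weight-one data `(μ, ⟨a⟩, χ)`, TEL frame, pinned `ιA` ∕ `ιV`: the pinned theta class `[Θ̃(χ̃_χ) ∘ ιA]` is a NON-ZERO `L²` class all of
whose discrete receivers `P′` (`pr_{P′} θ ≠ 0`) are HOLOMORPHIC-cotangent at `(ι, T)` with finite component `ω_H(μ, a, χ)[ιV]`.  PLAN = #12's, now inside the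
holomorphic engine's hypotheses: ★ `F0P2sThetaOccursInEngineGen.exists_holTheta_atFrame_of_chiN` (needs `hι : ι₁ ∈ hμ.cmType.1` — supplied) ∕ ★
`F0P2sThetaOccursInGenOriented.thetaOccursInGen_caseA ∕ of_embedding_mem`, ★ SP `F0P2dSocketD.holCotFormSpectralProjection_holds`, ★ B′
`F0P2sNodeBPrimeHolds.hasFinComponent_rhoAtLine_three_of_starProjection_ne_zero_of_coe`, ★ NV `F0P2tLineThetaLiftNeZeroOfArchFixed` ∕ `F0P2tThetaPairNeZeroOfFrame`,
★ `F0LD1ThetaTransportKit` at the pinned `ιA` (FRAME-1 for coherence).  Why it might fail: as #12 (transport of the engine's `∃ θ` to the pinned `ιA`); the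
orientation defect of #12 is removed by `hι`.  [cite: Liu2021, proof of Prop. 4.13 Case 1 (l. 2131–2137); App. D Lem. D.2 (2) (l. 5279–5289); Def. 4.12]
[cite: GelbartRogawski1991, §3.2 p. 457; Thm. 5.1.1 p. 465; Lem. 5.1.2 p. 466] [cite: Rallis1984, Thm. 1.2.2] [cite: Rogawski1990, Thm. 13.3.6]
size: L · deps: ★ engine, ★ SP, ★ B′, ★ NV, ★ `F0LD1ThetaTransportKit`, FRAME-1 · unit: CAPTURE · tier-2 target `Theorems/K2E2CapHolThetaWitnessOriented.lean` -/
theorem sig_K2E2CapHolThetaWitnessOriented :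
    ∀ (L : Type) [Field L] [NumberField L] [IsCMField L] (ι : L →+* ℂ) (H : Matrix (Fin 3) (Fin 3) L) (T : GL (Fin 3) ℂ)
      (hT : (T : Matrix (Fin 3) (Fin 3) ℂ)ᴴ * H.map ι * (T : Matrix (Fin 3) (Fin 3) ℂ) = Literature.Geometry.ComplexHyperbolic.BallModel.J),
      (∀ τ' : L →+* ℂ, InfinitePlace.mk τ' ≠ InfinitePlace.mk ι → (H.map τ').PosDef) → 2 ≤ Module.finrank ℚ ↥(maximalRealSubfield L) →
      ∀ {n' : ℕ} (e₁ : Fin 3 × Fin 1 ≃ Fin n') (dV : Fin 3 → L) (hdV : ∀ i, IsCMField.complexConj L (dV i) = dV i)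
        (hdV0 : ∀ i, dV i ≠ 0) (g : GL (Fin 3) L)
        (hg : ((g : Matrix (Fin 3) (Fin 3) L).map (cmConjRingHom L))ᵀ * H * (g : Matrix (Fin 3) (Fin 3) L) = Matrix.diagonal dV)
        (ιA : (adelicGroupData (↥(maximalRealSubfield L)) L (IsCMField.complexConj L) 3 H).Adelic →*
            ↥(UnitaryGroup.adelic (↥(maximalRealSubfield L)) L (IsCMField.complexConj L) 3 (Matrix.diagonal dV))),
          (∀ k, ((ιA k : ↥(UnitaryGroup.adelic (↥(maximalRealSubfield L)) L (IsCMField.complexConj L) 3 (Matrix.diagonal dV))) :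
                GL (Fin 3) (AdeleRing (𝓞 L) L)) =
              (toAdeleGL L g)⁻¹ * adelicVal (↥(maximalRealSubfield L)) L (IsCMField.complexConj L) 3 H k * toAdeleGL L g) →
        ∀ (ιV : finAdelic (↥(maximalRealSubfield L)) L (IsCMField.complexConj L) 3 H →*
            finAdelic (↥(maximalRealSubfield L)) L (IsCMField.complexConj L) 3 (Matrix.diagonal dV)),
          (∀ k, ((ιV k : finAdelic (↥(maximalRealSubfield L)) L (IsCMField.complexConj L) 3 (Matrix.diagonal dV)) :
              GL (Fin 3) (FiniteAdeleRing (𝓞 L) L)) =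
            (toFinAdeleGL L 3 g)⁻¹ * (k : GL (Fin 3) (FiniteAdeleRing (𝓞 L) L)) * toFinAdeleGL L 3 g) →
        ∀ [CompactSpace (↥(UnitaryGroup.adelic (↥(maximalRealSubfield L)) L (IsCMField.complexConj L) 3 (Matrix.diagonal dV)) ⧸
            (UnitaryGroup.toAdelic (↥(maximalRealSubfield L)) L (IsCMField.complexConj L) 3 (Matrix.diagonal dV)).range)],
        ∀ (μA : Measure (adelicGroupData (↥(maximalRealSubfield L)) L (IsCMField.complexConj L) 3 H).automorphicQuotient)
          [(adelicGroupData (↥(maximalRealSubfield L)) L (IsCMField.complexConj L) 3 H).IsAutomorphicMeasure μA]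
          (μ : Literature.NumberTheory.Automorphic.IdeleClassGroup L →ₜ* Circle) (hμ : IsConjugateSymplectic L μ), HasWeight L μ 1 →
          ι ∈ hμ.cmType.1 →
          ∀ (a : (↥(maximalRealSubfield L))ˣ) (χ : Chi (↥(maximalRealSubfield L)) L (IsCMField.complexConj L)),
            IsAdmissibleElement L hμ.cmType.1 (algebraMap (↥(maximalRealSubfield L)) L a * (2 * imagUnit L)⁻¹) →
            letI : MeasurableSpace (↥(UnitaryGroup.adelic (↥(maximalRealSubfield L)) L (IsCMField.complexConj L) 1
                (JW (↥(maximalRealSubfield L)) L a)) ⧸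
                  (UnitaryGroup.toAdelic (↥(maximalRealSubfield L)) L (IsCMField.complexConj L) 1 (JW (↥(maximalRealSubfield L)) L a)).range) :=
              borel _
            ∃ (hρ : HasThetaMajorants fun
                (p : ↥(UnitaryGroup.adelic (↥(maximalRealSubfield L)) L (IsCMField.complexConj L) 3 (Matrix.diagonal dV)) ×
                  ↥(UnitaryGroup.adelic (↥(maximalRealSubfield L)) L (IsCMField.complexConj L) 1 (JW (↥(maximalRealSubfield L)) L a)))
                (Φ : piSchwartzBruhat (↥(maximalRealSubfield L)) (Fin n')) =>
                  pairRep (↥(maximalRealSubfield L)) L (IsCMField.complexConj L) 3 1 e₁ (Matrix.diagonal dV) (JW (↥(maximalRealSubfield L)) L a)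
                    (chiSplittingLine L e₁ dV hdV hdV0 (toHeckeCharacter L μ) (isUnitary_toHeckeCharacter L μ)
                      ((isOscillatorChar_toHeckeCharacter_iff μ).mpr hμ) (TW (↥(maximalRealSubfield L)) a)
                      (isUnit_det_TW (↥(maximalRealSubfield L)) a) (JW (↥(maximalRealSubfield L)) L a) (JW_eq (↥(maximalRealSubfield L)) L a))
                    p Φ)
              (μW : Measure (↥(UnitaryGroup.adelic (↥(maximalRealSubfield L)) L (IsCMField.complexConj L) 1
                (JW (↥(maximalRealSubfield L)) L a)) ⧸
                  (UnitaryGroup.toAdelic (↥(maximalRealSubfield L)) L (IsCMField.complexConj L) 1 (JW (↥(maximalRealSubfield L)) L a)).range))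
              (_ : IsFiniteMeasure μW)
              (_ : SMulInvariantMeasure
                (↥(UnitaryGroup.adelic (↥(maximalRealSubfield L)) L (IsCMField.complexConj L) 1 (JW (↥(maximalRealSubfield L)) L a)))
                (↥(UnitaryGroup.adelic (↥(maximalRealSubfield L)) L (IsCMField.complexConj L) 1 (JW (↥(maximalRealSubfield L)) L a)) ⧸
                  (UnitaryGroup.toAdelic (↥(maximalRealSubfield L)) L (IsCMField.complexConj L) 1 (JW (↥(maximalRealSubfield L)) L a)).range)
                μW)
              (f : C(↥(UnitaryGroup.adelic (↥(maximalRealSubfield L)) L (IsCMField.complexConj L) 1 (JW (↥(maximalRealSubfield L)) L a)) ⧸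
                (UnitaryGroup.toAdelic (↥(maximalRealSubfield L)) L (IsCMField.complexConj L) 1 (JW (↥(maximalRealSubfield L)) L a)).range, ℂ))
              (Φ : piSchwartzBruhat (↥(maximalRealSubfield L)) (Fin n'))
              (hθ : MemLp (toQuotFun (adelicGroupData (↥(maximalRealSubfield L)) L (IsCMField.complexConj L) 3 H) fun x =>
                (lineThetaKernelDatum L 3 e₁ dV hdV hdV0 μ hμ a hρ).thetaLiftFun μW Φ f (ιA x)) 2 μA),
              MemLp.toLp _ hθ ≠ 0 ∧
              ∀ P' : DiscreteAutomorphicRep (adelicGroupData (↥(maximalRealSubfield L)) L (IsCMField.complexConj L) 3 H) μA,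
                P'.space.toSubmodule.starProjection (MemLp.toLp _ hθ) ≠ 0 →
                P'.IsHolCotangentAt (cmArchSection L ι H T hT) (cmCompactFactor L ι H T hT) ∧
                P'.HasFinComponent
                  (rhoAtLine (↥(maximalRealSubfield L)) L (IsCMField.complexConj L) 3 e₁ (Matrix.diagonal dV)
                    (complexConj_imagUnit L) (imagUnit_ne_zero L) (imagUnit_mul_self L) (realDiagonal_isSymm L dV hdV)
                    (isUnit_det_realDiagonal L dV hdV hdV0) (realDiagonal_map L dV hdV).symm
                    (fun a => isCompatible_chiSplittingLine L e₁ dV hdV hdV0 (toHeckeCharacter L μ)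
                      (isUnitary_toHeckeCharacter L μ) ((isOscillatorChar_toHeckeCharacter_iff μ).mpr hμ)
                      (TW (↥(maximalRealSubfield L)) a) (isSymm_TW (↥(maximalRealSubfield L)) a)
                      (isUnit_det_TW (↥(maximalRealSubfield L)) a) (JW (↥(maximalRealSubfield L)) L a)
                      (JW_eq (↥(maximalRealSubfield L)) L a)) ιV a χ) :=
  @Summit.HodgeConjecture.HodgeConjecture.Cruxes.H413.K2E2CapHolThetaWitnessOriented.capHolThetaWitnessOriented_of_archRowsGen sig_K2E2CapArchRowsGen  -- ★ RE-TIED MODULO #20 (p855353, K2E2-p12; statement bytes above FROZEN)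

set_option synthInstance.maxHeartbeats 400000 in
set_option maxHeartbeats 16000000 in
/-- **WITHDRAWN (ED. 3, 2026-09-03; bytes kept frozen as the negative edge) — its hypotheses are never met at `ι ∉ hμ.cmType.1` but its only proof road (#12) is
false there; superseded by `sig_K2E2CapThetaClassCaptureOriented` (#13R) below, which re-ties the tier-0 `stub_thetaClassCaptureR`.  DO NOT PROVE.**
**sig CAP-2 = the tier-0 stub `StubThetaClassCapture` VERBATIM (closer, size S given CAP-1 + `L2Completeness.sig_K2E2L2MemOfProjectionRigidity`).**
TEL frame, pinned `ιA` ∕ `ιV`, `[U(diag dV)]` compact, automorphic `μA`: a holomorphic-cotangent `P` with finite component `ω_H(μ, a, χ)[ιV]` (`μ` weight one,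
`a(2δ_L)⁻¹` admissible for `hμ.cmType`) which is the ONLY holomorphic-cotangent discrete representation with that finite component MEETS the theta lift from the
line `⟨a⟩` along `ιA`.  PLAN: take the package of `sig_K2E2CapHolThetaWitness`; every receiver `P′` of the class is holomorphic-cotangent with finite component
`ω_H(μ,a,χ)`, hence `= P` by the rigidity hypothesis; `L²([U(H)])` is discretely decomposable (★ `isDiscretelyDecomposable_rightRegular_adelicGroupData`, `H`
anisotropic from `hpos`: ★ `anisotropic_of_posDef_map`) and the quotient compact (★ `F0P3…`∕AFA frame facts), so `sig_K2E2L2MemOfProjectionRigidity` puts the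
class in `P.space`; it is non-zero; this is `MeetsThetaLiftFromLine` by definition (same `hρ`, `μW`, `f`, `Φ`, `hθ`).
[cite: Liu2021, proof of Prop. 4.13 Case 1 (l. 2131–2137, p. 48); App. B §B.2 (l. 4257–4262)] [cite: GelbartRogawski1991, Thm. 5.1.1 p. 465]
[cite: Rogawski1990, Thm. 13.3.6] [cite: DeitmarEchterhoff2014, Thm. 9.2.2]
size: S · deps: CAP-1, L2-2, ★ discrete decomposability · unit: CAPTURE · re-ties tier-0 `stub_thetaClassCapture` · tier-2 target `Theorems/K2E2CapThetaClassCapture.lean` -/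
theorem sig_K2E2CapThetaClassCapture :
    ∀ (L : Type) [Field L] [NumberField L] [IsCMField L] (ι : L →+* ℂ) (H : Matrix (Fin 3) (Fin 3) L) (T : GL (Fin 3) ℂ)
      (hT : (T : Matrix (Fin 3) (Fin 3) ℂ)ᴴ * H.map ι * (T : Matrix (Fin 3) (Fin 3) ℂ) = Literature.Geometry.ComplexHyperbolic.BallModel.J),
      (∀ τ' : L →+* ℂ, InfinitePlace.mk τ' ≠ InfinitePlace.mk ι → (H.map τ').PosDef) → 2 ≤ Module.finrank ℚ ↥(maximalRealSubfield L) →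
      ∀ {n' : ℕ} (e₁ : Fin 3 × Fin 1 ≃ Fin n') (dV : Fin 3 → L) (hdV : ∀ i, IsCMField.complexConj L (dV i) = dV i)
        (hdV0 : ∀ i, dV i ≠ 0) (g : GL (Fin 3) L)
        (hg : ((g : Matrix (Fin 3) (Fin 3) L).map (cmConjRingHom L))ᵀ * H * (g : Matrix (Fin 3) (Fin 3) L) = Matrix.diagonal dV)
        (ιA : (adelicGroupData (↥(maximalRealSubfield L)) L (IsCMField.complexConj L) 3 H).Adelic →*
            ↥(UnitaryGroup.adelic (↥(maximalRealSubfield L)) L (IsCMField.complexConj L) 3 (Matrix.diagonal dV))),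
          (∀ k, ((ιA k : ↥(UnitaryGroup.adelic (↥(maximalRealSubfield L)) L (IsCMField.complexConj L) 3 (Matrix.diagonal dV))) :
                GL (Fin 3) (AdeleRing (𝓞 L) L)) =
              (toAdeleGL L g)⁻¹ * adelicVal (↥(maximalRealSubfield L)) L (IsCMField.complexConj L) 3 H k * toAdeleGL L g) →
        ∀ (ιV : finAdelic (↥(maximalRealSubfield L)) L (IsCMField.complexConj L) 3 H →*
            finAdelic (↥(maximalRealSubfield L)) L (IsCMField.complexConj L) 3 (Matrix.diagonal dV)),
          (∀ k, ((ιV k : finAdelic (↥(maximalRealSubfield L)) L (IsCMField.complexConj L) 3 (Matrix.diagonal dV)) :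
              GL (Fin 3) (FiniteAdeleRing (𝓞 L) L)) =
            (toFinAdeleGL L 3 g)⁻¹ * (k : GL (Fin 3) (FiniteAdeleRing (𝓞 L) L)) * toFinAdeleGL L 3 g) →
        ∀ [CompactSpace (↥(UnitaryGroup.adelic (↥(maximalRealSubfield L)) L (IsCMField.complexConj L) 3 (Matrix.diagonal dV)) ⧸
            (UnitaryGroup.toAdelic (↥(maximalRealSubfield L)) L (IsCMField.complexConj L) 3 (Matrix.diagonal dV)).range)],
        ∀ (μA : Measure (adelicGroupData (↥(maximalRealSubfield L)) L (IsCMField.complexConj L) 3 H).automorphicQuotient)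
          [(adelicGroupData (↥(maximalRealSubfield L)) L (IsCMField.complexConj L) 3 H).IsAutomorphicMeasure μA]
          (P : DiscreteAutomorphicRep (adelicGroupData (↥(maximalRealSubfield L)) L (IsCMField.complexConj L) 3 H) μA),
          P.IsHolCotangentAt (cmArchSection L ι H T hT) (cmCompactFactor L ι H T hT) →
          ∀ (μ : Literature.NumberTheory.Automorphic.IdeleClassGroup L →ₜ* Circle) (hμ : IsConjugateSymplectic L μ), HasWeight L μ 1 →
            ∀ (a : (↥(maximalRealSubfield L))ˣ) (χ : Chi (↥(maximalRealSubfield L)) L (IsCMField.complexConj L)),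
              IsAdmissibleElement L hμ.cmType.1 (algebraMap (↥(maximalRealSubfield L)) L a * (2 * imagUnit L)⁻¹) →
              P.HasFinComponent
                (rhoAtLine (↥(maximalRealSubfield L)) L (IsCMField.complexConj L) 3 e₁ (Matrix.diagonal dV)
                  (complexConj_imagUnit L) (imagUnit_ne_zero L) (imagUnit_mul_self L) (realDiagonal_isSymm L dV hdV)
                  (isUnit_det_realDiagonal L dV hdV hdV0) (realDiagonal_map L dV hdV).symm
                  (fun a => isCompatible_chiSplittingLine L e₁ dV hdV hdV0 (toHeckeCharacter L μ)
                    (isUnitary_toHeckeCharacter L μ) ((isOscillatorChar_toHeckeCharacter_iff μ).mpr hμ)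
                    (TW (↥(maximalRealSubfield L)) a) (isSymm_TW (↥(maximalRealSubfield L)) a)
                    (isUnit_det_TW (↥(maximalRealSubfield L)) a) (JW (↥(maximalRealSubfield L)) L a)
                    (JW_eq (↥(maximalRealSubfield L)) L a)) ιV a χ) →
              (∀ P' : DiscreteAutomorphicRep (adelicGroupData (↥(maximalRealSubfield L)) L (IsCMField.complexConj L) 3 H) μA,
                  P'.IsHolCotangentAt (cmArchSection L ι H T hT) (cmCompactFactor L ι H T hT) →
                  P'.HasFinComponent
                    (rhoAtLine (↥(maximalRealSubfield L)) L (IsCMField.complexConj L) 3 e₁ (Matrix.diagonal dV)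
                      (complexConj_imagUnit L) (imagUnit_ne_zero L) (imagUnit_mul_self L) (realDiagonal_isSymm L dV hdV)
                      (isUnit_det_realDiagonal L dV hdV hdV0) (realDiagonal_map L dV hdV).symm
                      (fun a => isCompatible_chiSplittingLine L e₁ dV hdV hdV0 (toHeckeCharacter L μ)
                        (isUnitary_toHeckeCharacter L μ) ((isOscillatorChar_toHeckeCharacter_iff μ).mpr hμ)
                        (TW (↥(maximalRealSubfield L)) a) (isSymm_TW (↥(maximalRealSubfield L)) a)
                        (isUnit_det_TW (↥(maximalRealSubfield L)) a) (JW (↥(maximalRealSubfield L)) L a)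
                        (JW_eq (↥(maximalRealSubfield L)) L a)) ιV a χ) →
                  P' = P) →
              MeetsThetaLiftFromLine L 3 H e₁ dV hdV hdV0 P μ hμ a ιA := by
  sorry

set_option synthInstance.maxHeartbeats 400000 in
set_option maxHeartbeats 16000000 in
/-- **sig CAP-2R `sig_K2E2CapThetaClassCaptureOriented` (#13R, closer, size S given #12R + `L2Completeness.sig_K2E2L2MemOfProjectionRigidity`; SUPERSEDES the
withdrawn #13) = the tier-0 stub `StubThetaClassCaptureR` VERBATIM** (= #13 + ONE binder `ι ∈ hμ.cmType.1` after `HasWeight L μ 1`).  PLAN = #13's with #12R in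
place of #12.  Re-ties tier-0 `stub_thetaClassCaptureR`.  [cite: Liu2021, proof of Prop. 4.13 Case 1 (l. 2131–2137); App. B §B.2 (l. 4257–4262)]
[cite: GelbartRogawski1991, Thm. 5.1.1 p. 465] [cite: Rogawski1990, Thm. 13.3.6] [cite: DeitmarEchterhoff2014, Thm. 9.2.2]
size: S · deps: CAP-1R, L2-2 · unit: CAPTURE · tier-2 target `Theorems/K2E2CapThetaClassCaptureOriented.lean` -/
theorem sig_K2E2CapThetaClassCaptureOriented :
    ∀ (L : Type) [Field L] [NumberField L] [IsCMField L] (ι : L →+* ℂ) (H : Matrix (Fin 3) (Fin 3) L) (T : GL (Fin 3) ℂ)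
      (hT : (T : Matrix (Fin 3) (Fin 3) ℂ)ᴴ * H.map ι * (T : Matrix (Fin 3) (Fin 3) ℂ) = Literature.Geometry.ComplexHyperbolic.BallModel.J),
      (∀ τ' : L →+* ℂ, InfinitePlace.mk τ' ≠ InfinitePlace.mk ι → (H.map τ').PosDef) → 2 ≤ Module.finrank ℚ ↥(maximalRealSubfield L) →
      ∀ {n' : ℕ} (e₁ : Fin 3 × Fin 1 ≃ Fin n') (dV : Fin 3 → L) (hdV : ∀ i, IsCMField.complexConj L (dV i) = dV i)
        (hdV0 : ∀ i, dV i ≠ 0) (g : GL (Fin 3) L)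
        (hg : ((g : Matrix (Fin 3) (Fin 3) L).map (cmConjRingHom L))ᵀ * H * (g : Matrix (Fin 3) (Fin 3) L) = Matrix.diagonal dV)
        (ιA : (adelicGroupData (↥(maximalRealSubfield L)) L (IsCMField.complexConj L) 3 H).Adelic →*
            ↥(UnitaryGroup.adelic (↥(maximalRealSubfield L)) L (IsCMField.complexConj L) 3 (Matrix.diagonal dV))),
          (∀ k, ((ιA k : ↥(UnitaryGroup.adelic (↥(maximalRealSubfield L)) L (IsCMField.complexConj L) 3 (Matrix.diagonal dV))) :
                GL (Fin 3) (AdeleRing (𝓞 L) L)) =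
              (toAdeleGL L g)⁻¹ * adelicVal (↥(maximalRealSubfield L)) L (IsCMField.complexConj L) 3 H k * toAdeleGL L g) →
        ∀ (ιV : finAdelic (↥(maximalRealSubfield L)) L (IsCMField.complexConj L) 3 H →*
            finAdelic (↥(maximalRealSubfield L)) L (IsCMField.complexConj L) 3 (Matrix.diagonal dV)),
          (∀ k, ((ιV k : finAdelic (↥(maximalRealSubfield L)) L (IsCMField.complexConj L) 3 (Matrix.diagonal dV)) :
              GL (Fin 3) (FiniteAdeleRing (𝓞 L) L)) =
            (toFinAdeleGL L 3 g)⁻¹ * (k : GL (Fin 3) (FiniteAdeleRing (𝓞 L) L)) * toFinAdeleGL L 3 g) →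
        ∀ [CompactSpace (↥(UnitaryGroup.adelic (↥(maximalRealSubfield L)) L (IsCMField.complexConj L) 3 (Matrix.diagonal dV)) ⧸
            (UnitaryGroup.toAdelic (↥(maximalRealSubfield L)) L (IsCMField.complexConj L) 3 (Matrix.diagonal dV)).range)],
        ∀ (μA : Measure (adelicGroupData (↥(maximalRealSubfield L)) L (IsCMField.complexConj L) 3 H).automorphicQuotient)
          [(adelicGroupData (↥(maximalRealSubfield L)) L (IsCMField.complexConj L) 3 H).IsAutomorphicMeasure μA]
          (P : DiscreteAutomorphicRep (adelicGroupData (↥(maximalRealSubfield L)) L (IsCMField.complexConj L) 3 H) μA),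
          P.IsHolCotangentAt (cmArchSection L ι H T hT) (cmCompactFactor L ι H T hT) →
          ∀ (μ : Literature.NumberTheory.Automorphic.IdeleClassGroup L →ₜ* Circle) (hμ : IsConjugateSymplectic L μ), HasWeight L μ 1 →
            ι ∈ hμ.cmType.1 →
            ∀ (a : (↥(maximalRealSubfield L))ˣ) (χ : Chi (↥(maximalRealSubfield L)) L (IsCMField.complexConj L)),
              IsAdmissibleElement L hμ.cmType.1 (algebraMap (↥(maximalRealSubfield L)) L a * (2 * imagUnit L)⁻¹) →
              P.HasFinComponent
                (rhoAtLine (↥(maximalRealSubfield L)) L (IsCMField.complexConj L) 3 e₁ (Matrix.diagonal dV)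
                  (complexConj_imagUnit L) (imagUnit_ne_zero L) (imagUnit_mul_self L) (realDiagonal_isSymm L dV hdV)
                  (isUnit_det_realDiagonal L dV hdV hdV0) (realDiagonal_map L dV hdV).symm
                  (fun a => isCompatible_chiSplittingLine L e₁ dV hdV hdV0 (toHeckeCharacter L μ)
                    (isUnitary_toHeckeCharacter L μ) ((isOscillatorChar_toHeckeCharacter_iff μ).mpr hμ)
                    (TW (↥(maximalRealSubfield L)) a) (isSymm_TW (↥(maximalRealSubfield L)) a)
                    (isUnit_det_TW (↥(maximalRealSubfield L)) a) (JW (↥(maximalRealSubfield L)) L a)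
                    (JW_eq (↥(maximalRealSubfield L)) L a)) ιV a χ) →
              (∀ P' : DiscreteAutomorphicRep (adelicGroupData (↥(maximalRealSubfield L)) L (IsCMField.complexConj L) 3 H) μA,
                  P'.IsHolCotangentAt (cmArchSection L ι H T hT) (cmCompactFactor L ι H T hT) →
                  P'.HasFinComponent
                    (rhoAtLine (↥(maximalRealSubfield L)) L (IsCMField.complexConj L) 3 e₁ (Matrix.diagonal dV)
                      (complexConj_imagUnit L) (imagUnit_ne_zero L) (imagUnit_mul_self L) (realDiagonal_isSymm L dV hdV)
                      (isUnit_det_realDiagonal L dV hdV hdV0) (realDiagonal_map L dV hdV).symm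
                      (fun a => isCompatible_chiSplittingLine L e₁ dV hdV hdV0 (toHeckeCharacter L μ)
                        (isUnitary_toHeckeCharacter L μ) ((isOscillatorChar_toHeckeCharacter_iff μ).mpr hμ)
                        (TW (↥(maximalRealSubfield L)) a) (isSymm_TW (↥(maximalRealSubfield L)) a)
                        (isUnit_det_TW (↥(maximalRealSubfield L)) a) (JW (↥(maximalRealSubfield L)) L a)
                        (JW_eq (↥(maximalRealSubfield L)) L a)) ιV a χ) →
                  P' = P) →
              MeetsThetaLiftFromLine L 3 H e₁ dV hdV hdV0 P μ hμ a ιA :=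
  fun L _ _ _ ι H T hT hpos h2 =>
    @Summit.HodgeConjecture.HodgeConjecture.Cruxes.H413.K2E2CapThetaClassCaptureOriented.capThetaClassCaptureOriented_of sig_K2E2CapHolThetaWitnessOriented
      @Summit.HodgeConjecture.HodgeConjecture.Cruxes.H413.K2E2L2MemOfProjectionRigidity.memOfProjectionRigidity L _ _ _ ι H T hT hpos h2  -- ★ #13R RE-TIED MODULO #12R (fold p855041 ∘ #10 p854820)

end Summit.HodgeConjecture.HodgeConjecture.Cruxes.H413.K2E2ThetaExhaustionByRigidity.Capture
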